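import Mathlib
import Summits.AtomisticToContinuum.HydrodynamicLimit.Theses.InformationPercolationEngine

/-!
# Crux-ideate r1 / ideator 1 — `KickFairRelEquilibriumMeso` (stmt-AtomisticToContinuum-15177)

Sketch file for the idea card `two-time-pinch` ("time zero pays the entropy bill forever;
restart every `T` flights at the cellwise-microcanonical invariant law; what is left is
kinetic-window restart fairness under a coarse backward conditioning").

Contents (all over existing declarations; sorries only in the two abstract lemmas L1/L2, which are
provable-now class):

* `maxwellian_logTilt_eq` (L1, the VELOCITY BILL VANISHES): the log-density of a product of local
  Maxwellians `M_{1,u,θ}` against standard Maxwellians is an affine function of the cell momentum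
  `∑ v_j` and the cell kinetic energy `∑ ‖v_j‖²` — so conditioning on (count, momentum, energy) per
  cell makes the velocity part of `d LG / d G` measurable w.r.t. the conditioning, i.e. free.
* `condEntropy_ineq` (L2, the TRANSFER STEP): entropy inequality with a conditioned reference —
  `∫ f dμ ≤ [KL(μ‖ν) − KL(μ∘π⁻¹ ‖ ν∘π⁻¹)] + ∫ log ν[e^f | σ(π)] dμ`; with `π` = (cell data at time
  0, cell data at the slot start) the bracket is the time-zero static bill, whatever the slot.
* `cellData` — the conditioning statistic: per `r`-cell (count, momentum, twice kinetic energy).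
* `StaticCellBill` (stub S0, typed): the bracket is `≤ C (N+1) rs_N²` at the crux's own scale.
* `slotKickSum` — the crux's compensated kick sum restricted to kicks with `t_{i,n} ∈ (t₁, t₂]`
  (the crux's `let`-chain verbatim, one extra indicator).
* `RestartBias` / `RestartConcentration` (stubs R1/R2, typed): under the INVARIANT law conditioned
  on a time-zero cell-data bin and a slot-start cell-data bin of joint probability `≥ e^{-M(N+1)}`,
  the slot sum over `T` flights has conditional mean `o(T (N+1)^{-1/3})` (one-sided chaos: a coarse
  PAST conditioning does not bias FUTURE centred kicks) and sub-Gaussian fluctuations at the CLT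
  scale of `N` independent patches (variance proxy `C_T T² (N+1)^{-5/3}`).
-/

namespace Summit.AtomisticToContinuum.HydrodynamicLimit.Cruxes.KickFairRelEquilibriumMeso.TwoTimePinch

open MeasureTheory
open scoped InnerProductSpace BigOperators ENNReal Classical

noncomputable section

open Literature.MathematicalPhysics.KineticTheory (T3 V3 hsDiameter localGibbsLaw)
open Literature.Analysis.FluidPDE (HardSphereFlow Config collisionTimesOf flightStart Geometry)

/-! ## L1 — the velocity bill vanishes -/

/-- **L1 (velocity bill).** For a bulk velocity `u` and temperature `θ`, the log-ratio
`∑_j [‖v_j‖²/2 − ‖v_j − u‖²/(2θ)]` of `∏_j M_{1,u,θ}(v_j)` against `∏_j M_{1,0,1}(v_j)` (up to the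
`j`-independent normalisations) is an affine function of `∑_j ‖v_j‖²` and `∑_j v_j` only. Hence,
conditionally on the per-cell momentum and kinetic energy (both read off the EXACT velocities in the
crux's typed past), a cellwise-constant Maxwellian tilt is measurable w.r.t. the conditioning and
drops out of every conditional law (`condExp_withDensity_ae_eq_of_measurable`, p99854). [folklore] -/
theorem maxwellian_logTilt_eq (u : V3) (θ : ℝ) {n : ℕ} (v : Fin n → V3) :
    ∑ j, (‖v j‖ ^ 2 / 2 - ‖v j - u‖ ^ 2 / (2 * θ)) =
      (1 / 2 - 1 / (2 * θ)) * ∑ j, ‖v j‖ ^ 2 + θ⁻¹ * ⟪∑ j, v j, u⟫_ℝ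
        - (n : ℝ) * ‖u‖ ^ 2 / (2 * θ) := by
  have key : ∀ j, ‖v j‖ ^ 2 / 2 - ‖v j - u‖ ^ 2 / (2 * θ) =
      (1 / 2 - 1 / (2 * θ)) * ‖v j‖ ^ 2 + θ⁻¹ * ⟪v j, u⟫_ℝ - ‖u‖ ^ 2 / (2 * θ) := by
    intro j
    rw [norm_sub_sq_real]
    ring
  simp_rw [key]
  rw [Finset.sum_sub_distrib, Finset.sum_add_distrib, ← Finset.mul_sum, ← Finset.mul_sum,
    sum_inner, Finset.sum_const, Finset.card_univ, Fintype.card_fin, nsmul_eq_mul]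
  ring

/-! ## L2 — entropy inequality with a conditioned reference -/

/-- **L2 (conditional entropy inequality; transfer step of the two-time pinch).** For probability
measures `μ ≪ ν` with `KL(μ‖ν) < ∞`, a measurable coarse map `π` and an exponentially
`ν`-integrable `f`:
`∫ f dμ ≤ [KL(μ‖ν) − KL(μ∘π⁻¹ ‖ ν∘π⁻¹)] + ∫ log (ν[e^f | σ(π)]) dμ`.
Proof plan (provable now): chain rule `KL(μ‖ν) = KL(marginals) + E_μ KL(μ_π ‖ ν_π)` (disintegration
on a standard Borel space, or directly via `Measure.tilted` by the `σ(π)`-measurable tilt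
`e^f / ν[e^f|σ(π)]`, exactly as in `KipnisLandim1999_A1_8_2_holds`) and the fibrewise
Donsker–Varadhan inequality. In the line, `π z₀ = (cellData (rs N) z₀, cellData (rs N) (Φ_{t_s} z₀))`
and the bracket is bounded by `StaticCellBill` for EVERY slot start `t_s` (data processing: the
time-zero component alone already carries `KL(μ‖ν) − O((N+1) rs_N²)`). [folklore] -/
theorem condEntropy_ineq {Ω S : Type*} [MeasurableSpace Ω] [mS : MeasurableSpace S]
    (μ ν : Measure Ω) [IsProbabilityMeasure μ] [IsProbabilityMeasure ν]
    (π : Ω → S) (hπ : Measurable π) (f : Ω → ℝ) (hf : Measurable f)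
    (hfμ : Integrable f μ) (hfν : Integrable (fun ω => Real.exp (f ω)) ν)
    (hkl : InformationTheory.klDiv μ ν ≠ ⊤) :
    ∫ ω, f ω ∂μ ≤
      ((InformationTheory.klDiv μ ν).toReal
          - (InformationTheory.klDiv (μ.map π) (ν.map π)).toReal)
        + ∫ ω, Real.log ((MeasureTheory.condExp (MeasurableSpace.comap π mS) ν
            (fun ω => Real.exp (f ω))) ω) ∂μ := by
  sorry

/-! ## The conditioning statistic and the static bill (stub S0) -/

/-- **Cell data at mesh `r`**: for each `r`-cell `k` of `𝕋³`, the number of particles in it, their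
total momentum and twice their total kinetic energy — all three are functions of the crux's typed
past whenever one of the two flight-start photos is taken at the same instant (cells + EXACT
velocities of all spheres). -/
def cellData {N : ℕ} (r : ℝ) (z : Config (N + 1) (Fin 3) T3) (k : Fin 3 → ℤ) : ℕ × V3 × ℝ :=
  let I : Finset (Fin (N + 1)) :=
    Finset.univ.filter fun i => Literature.Analysis.FluidPDE.Torus.coarseCell r (z i).1 = k
  (I.card, ∑ i ∈ I, (z i).2, ∑ i ∈ I, ‖(z i).2‖ ^ 2)

/-- **Stub S0 — STATIC CELL BILL (equivalence of ensembles inside the crux's cells; provable-now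
class, size M/L).** For Lipschitz positive profiles, conditioning the local Gibbs law `LG` and the
invariant canonical law `G` on the time-zero cell data at the crux's mesh `rs N` costs all but
`C (N+1) (rs N)²` of their relative entropy: the hard-core indicator cancels in `dLG/dG`, the
cellwise-constant part of the one-body tilt is measurable w.r.t. the conditioning (L1 for the
velocities), and the intra-cell remainder is `O(rs N)` per particle with vanishing first order.
This is the ENTROPY form of the fixed-cell clustering defect of Disproof F2 (`c₂ ∝ r²`): it is
`o(N)` exactly when `rs N → 0`. -/
def StaticCellBill (rs : ℕ → ℝ) : Prop :=
  ∀ (a₀ θ₀ : T3 → ℝ) (u₀ : T3 → V3),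
    (∃ L : NNReal, LipschitzWith L a₀ ∧ LipschitzWith L θ₀ ∧ LipschitzWith L u₀) →
    (∀ x, 0 < a₀ x) → (∀ x, 0 < θ₀ x) →
    ∀ σ : ℝ, 0 < σ → σ < 1 / 2 → ∃ C : ℝ, ∀ N : ℕ,
    ∀ Φ : HardSphereFlow (Literature.Analysis.FluidPDE.Torus.geometry (Fin 3)) (hsDiameter σ N) (N + 1),
    let LG := localGibbsLaw σ a₀ u₀ θ₀ N Φ
    let G := localGibbsLaw σ (fun _ => 1) (fun _ => 0) (fun _ => 1) N Φ
    InformationTheory.klDiv LG G ≤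
      InformationTheory.klDiv (LG.map (cellData (rs N))) (G.map (cellData (rs N))) +
        ENNReal.ofReal (C * ((N : ℝ) + 1) * rs N ^ 2)

/-! ## The slot kick sum and the restart stubs (R1/R2) -/

/-- **The crux's compensated kick sum restricted to a time window `(t₁, t₂]`** — the `let`-chain
of `KickFairRelEquilibriumMeso` verbatim (same `ε, G, q, γ, cnt, P, X, κ`; `κ` under the INVARIANT
law given the comap σ-algebra of the typed past at mesh `r`), with one extra indicator on the
collision time. Summing the windows of a partition of `(0, τ]` returns the crux's `S`. -/
def slotKickSum (σ : ℝ) (N : ℕ)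
    (Φ : HardSphereFlow (Literature.Analysis.FluidPDE.Torus.geometry (Fin 3)) (hsDiameter σ N) (N + 1))
    (τ r t₁ t₂ : ℝ) (g : V3 × V3 × V3 → ℝ)
    (h : Fin (N + 1) → ℕ →
      (((Fin (N + 1) → (Fin 3 → ℤ) × V3) × (Fin (N + 1) → (Fin 3 → ℤ) × V3)) × Fin (N + 1)) ×
        (ℝ × ℝ × ℝ) → ℝ)
    (z : Config (N + 1) (Fin 3) T3) : ℝ :=
  let ε := hsDiameter σ N
  let G : Geometry (Fin 3) T3 := Literature.Analysis.FluidPDE.Torus.geometry (Fin 3)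
  let q : T3 → (Fin 3 → ℤ) := Literature.Analysis.FluidPDE.Torus.coarseCell r
  let γ : Config (N + 1) (Fin 3) T3 → ℝ → Config (N + 1) (Fin 3) T3 := fun z s => Φ.flow s z
  let cnt : Config (N + 1) (Fin 3) T3 → Fin (N + 1) → ℕ := fun z i =>
    Set.ncard (collisionTimesOf G ε (γ z) i ∩ Set.Ioc 0 τ)
  let P : Config (N + 1) (Fin 3) T3 → Fin (N + 1) → ℕ →
      (((Fin (N + 1) → (Fin 3 → ℤ) × V3) × (Fin (N + 1) → (Fin 3 → ℤ) × V3)) × Fin (N + 1)) ×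
        (ℝ × ℝ × ℝ) := fun z i n =>
    if z ∈ Φ.good then
      ((Φ.coarsePastOf q i n z, Φ.nthPartnerOf i n z),
        (flightStart G ε (γ z) 0 i (Φ.nthCollisionTimeOf i n z),
          flightStart G ε (γ z) 0 (Φ.nthPartnerOf i n z) (Φ.nthCollisionTimeOf i n z),
          Φ.nthCollisionTimeOf i n z))
    else (((fun _ => (0, 0), fun _ => (0, 0)), 0), (0, 0, 0))
  let X : Fin (N + 1) → ℕ → Config (N + 1) (Fin 3) T3 → V3 × V3 × V3 := fun i n z =>
    if z ∈ Φ.good then ((Φ.nthRecordOf i n z).impactVec, (Φ.nthRecordOf i n z).preVel) else 0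
  let κ : Fin (N + 1) → ℕ → Config (N + 1) (Fin 3) T3 → ℝ := fun i n =>
    MeasureTheory.condExp (MeasurableSpace.comap (fun z => P z i n) inferInstance)
      (localGibbsLaw σ (fun _ => 1) (fun _ => 0) (fun _ => 1) N Φ) (fun z => g (X i n z))
  ε / (N + 1 : ℝ) * ∑ i : Fin (N + 1), ∑ n ∈ Finset.range (cnt z i),
    (if t₁ < Φ.nthCollisionTimeOf i n z ∧ Φ.nthCollisionTimeOf i n z ≤ t₂ then (1 : ℝ) else 0) *
      (h i n (P z i n) * (g (X i n z) - κ i n z))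

/-- The **pinched reference event**: time-zero cell data in the bin `U₀` AND slot-start cell data
in the bin `U` (both at the crux's mesh `r`), as an event on initial data. Under the invariant law
`G`, conditioning on it gives the cellwise-microcanonical law at the slot start (explicit product
over cells, by invariance of `G`) tilted by the BACKWARD event "the coarse history started in `U₀`". -/
def pinchEvent {N : ℕ} {ε : ℝ}
    (Φ : HardSphereFlow (Literature.Analysis.FluidPDE.Torus.geometry (Fin 3)) ε (N + 1))
    (r ts : ℝ) (U₀ U : Set ((Fin 3 → ℤ) → ℕ × V3 × ℝ)) : Set (Config (N + 1) (Fin 3) T3) :=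
  {z | cellData r z ∈ U₀ ∧ cellData r (Φ.flow ts z) ∈ U}

/-- **Stub R1 — RESTART BIAS (one-sided chaos over a kinetic window; crux-sized).** Along an
admissible cell sequence `rs`, under the INVARIANT law conditioned on a pinch event of probability
`≥ e^{-M(N+1)}`, the compensated kick sum over the slot `(t_s, t_s + T·t_N]`, `t_N = (N+1)^{-1/3}`
(`≍ T σ²·⟨|v−w|⟩π` mean free times), has conditional mean `≤ δ · T · t_N` eventually, uniformly in
the slot start, the bins and the admissible weights. CONTENT: (i) kicks whose flight starts at the
slot start are κ-fair EXACTLY (the reference's kernel given the typed past IS `G`'s: cell-constant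
tilt, L1, p99854); (ii) later flights in the slot see intra-cell structure only within `T ℓ` of cell
faces (relative volume `T ℓ / rs N → 0` — the lower window edge); (iii) the time-zero bin `U₀` is a
COARSE PAST conditioning and does not bias FUTURE centred kicks — Boltzmann's one-sided chaos in its
weakest form (velocity reversal maps it to "a coarse future conditioning does not bias past
post-collisional data", which is not claimed). Pre-shock (iii) is void (the backward coarse path
from a cellwise-microcanonical start reaches `U₀` typically, by reversibility of smooth Euler).
The integrability conjunct guards the Bochner mean against junk (a non-integrable `Z` would make the
bound vacuous); it is measurability plumbing of the record maps plus a first-moment collision-count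
bound, asserted, not assumed. -/
def RestartBias (rs : ℕ → ℝ) : Prop :=
  ∀ σ : ℝ, 0 < σ → σ < 1 / 2 →
  ∀ Φ : (N : ℕ) → HardSphereFlow (Literature.Analysis.FluidPDE.Torus.geometry (Fin 3))
      (hsDiameter σ N) (N + 1),
  ∀ τ : ℝ, 0 < τ → ∀ g : V3 × V3 × V3 → ℝ, Continuous g → (∃ C : ℝ, ∀ p, |g p| ≤ C) →
  ∀ T : ℝ, 0 < T → ∀ M : ℝ, 0 ≤ M → ∀ δ : ℝ, 0 < δ → ∃ N₀ : ℕ, ∀ N : ℕ, N₀ ≤ N →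
  ∀ h : Fin (N + 1) → ℕ →
      (((Fin (N + 1) → (Fin 3 → ℤ) × V3) × (Fin (N + 1) → (Fin 3 → ℤ) × V3)) × Fin (N + 1)) ×
        (ℝ × ℝ × ℝ) → ℝ,
    (∀ i n, Measurable (h i n)) → (∀ i n p, |h i n p| ≤ 1) →
  ∀ ts : ℝ, 0 ≤ ts → ts ≤ τ →
  ∀ U₀ U : Set ((Fin 3 → ℤ) → ℕ × V3 × ℝ), MeasurableSet U₀ → MeasurableSet U →
    let tN : ℝ := ((N : ℝ) + 1) ^ (-(1 / 3 : ℝ))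
    let G := localGibbsLaw σ (fun _ => 1) (fun _ => 0) (fun _ => 1) N (Φ N)
    let A := pinchEvent (Φ N) (rs N) ts U₀ U
    let Z := slotKickSum σ N (Φ N) τ (rs N) ts (ts + T * tN) g h
    Integrable Z G ∧
      (ENNReal.ofReal (Real.exp (-(M * ((N : ℝ) + 1)))) ≤ G A →
        |∫ z in A, Z z ∂G| ≤ δ * T * tN * (G A).toReal)

/-- **Stub R2 — RESTART CONCENTRATION (kinetic-window, spatial; crux-sized).** Same setting: the
slot sum has sub-Gaussian conditional fluctuations about its conditional mean at the CLT scale of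
`≍ N` dynamically independent `Tℓ`-patches, i.e. variance proxy `C_T · T² · (N+1)^{-5/3}`:
`G(A ∩ {|Z − m_A| > u}) ≤ 2 exp(−u² (N+1)^{5/3} / (C_T T²)) · G(A)` for all `u ≥ 0`. CONTENT: over
`T` flights influence travels `≲ T ℓ` (plus Maxwellian-tail excursions), and at the slot start the
reference is an explicit product over cells; the technical debt is uniformity over weights `h`
that read the GLOBAL photo (the consumer `PercolationClosesChaos` only needs lineage-local ones). -/
def RestartConcentration (rs : ℕ → ℝ) : Prop :=
  ∀ σ : ℝ, 0 < σ → σ < 1 / 2 →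
  ∀ Φ : (N : ℕ) → HardSphereFlow (Literature.Analysis.FluidPDE.Torus.geometry (Fin 3))
      (hsDiameter σ N) (N + 1),
  ∀ τ : ℝ, 0 < τ → ∀ g : V3 × V3 × V3 → ℝ, Continuous g → (∃ C : ℝ, ∀ p, |g p| ≤ C) →
  ∀ T : ℝ, 0 < T → ∀ M : ℝ, 0 ≤ M → ∃ CT : ℝ, 0 < CT ∧ ∃ N₀ : ℕ, ∀ N : ℕ, N₀ ≤ N →
  ∀ h : Fin (N + 1) → ℕ →
      (((Fin (N + 1) → (Fin 3 → ℤ) × V3) × (Fin (N + 1) → (Fin 3 → ℤ) × V3)) × Fin (N + 1)) ×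
        (ℝ × ℝ × ℝ) → ℝ,
    (∀ i n, Measurable (h i n)) → (∀ i n p, |h i n p| ≤ 1) →
  ∀ ts : ℝ, 0 ≤ ts → ts ≤ τ →
  ∀ U₀ U : Set ((Fin 3 → ℤ) → ℕ × V3 × ℝ), MeasurableSet U₀ → MeasurableSet U →
    let tN : ℝ := ((N : ℝ) + 1) ^ (-(1 / 3 : ℝ))
    let G := localGibbsLaw σ (fun _ => 1) (fun _ => 0) (fun _ => 1) N (Φ N)
    let A := pinchEvent (Φ N) (rs N) ts U₀ U
    let Z := slotKickSum σ N (Φ N) τ (rs N) ts (ts + T * tN) g h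
    let m : ℝ := (G A).toReal⁻¹ * ∫ z in A, Z z ∂G
    ENNReal.ofReal (Real.exp (-(M * ((N : ℝ) + 1)))) ≤ G A →
      ∀ u : ℝ, 0 ≤ u →
        G (A ∩ {z | u < |Z z - m|}) ≤
          ENNReal.ofReal (2 * Real.exp (-(u ^ 2 * ((N : ℝ) + 1) ^ (5 / 3 : ℝ) / (CT * T ^ 2)))) * G A

/-! ## Sanity: the admissible cell sequence of the card lives in the crux's window -/

/-- The default sequence `rs N = (N+1)^{-1/4}` is positive. [folklore] -/
example (N : ℕ) : 0 < ((N : ℝ) + 1) ^ (-(1 / 4 : ℝ)) := by positivity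

end

end Summit.AtomisticToContinuum.HydrodynamicLimit.Cruxes.KickFairRelEquilibriumMeso.TwoTimePinch
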